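import Literature.Topology.FourManifolds.BordismFourFiniteness
import Literature.AlgebraicTopology.SingularHomology.PoincareDualityProofs
import Literature.AlgebraicTopology.SingularHomology.UniverseTransportCap
import Literature.AlgebraicTopology.SingularHomology.LefschetzDualityProofs
import Literature.AlgebraicTopology.SingularHomology.FundamentalClassProofs
import Mathlib.Topology.Instances.Shrink
import HarnessLib

/-!
# Thom's Cor. V.8 in dimension four, proved
(Layer 8 of `Literature.Topology.FourManifolds.isOrientedBordant_iff_signature_eq`)

Sibling proof file of `Literature.Topology.FourManifolds.BordismFourFiniteness`.  There the leaf
`Literature.Topology.FourManifolds.two_mul_boundaryImageRank_eq` (Thom 1952, Cor. V.8 for `n = 4`,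
`p = 2`: `2 r₂ = b₂(M) + b₂(N)` for the image `A² = i^* H²(W) ⊂ H²(∂W)` of an oriented cobordism
`W` between closed oriented smooth 4-manifolds `M`, `N`) and, through it, Thom's Thm IV.1 in
dimension four (bordism invariance of the signature) were proved from two named facts: Lefschetz
duality for compact 5-manifolds with boundary (`hL`, Spanier Thm. 6.3.12,
`Literature.AlgebraicTopology.SingularHomology.bijective_relCapProduct_of_isRelFundamentalClass`)
and Poincaré duality for closed 4-manifolds (`hD`, Hatcher Thm. 3.30,
`Literature.AlgebraicTopology.SingularHomology.bijective_poincareDualityMap`).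

Poincaré duality is now a theorem of `Literature` in every universe
(`Literature.AlgebraicTopology.SingularHomology.poincare_duality`, `…PoincareDualityProofs`:
Miller's Thm. 37.1 run along the compact subsets of a closed oriented manifold, `K = X`).  This
file discharges `hD`, and reduces `hL` to its instance in the lowest universe (the tree's engine
for Lefschetz duality — Čech duality in the external collar, `…ExternalCollarDuality`, Miller's
Thm. 37.1 — lives in `Type`):

* `isBoundaryPoint_comp_iff`, `isRelFundamentalClass_iff_of_xEquiv`,
  `bijective_relCapProduct_of_isRelFundamentalClass_of_univ` — **Lefschetz duality (Spanier
  Thm. 6.3.12) in every universe from Lefschetz duality in `Type`**: transport along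
  `W ≃ₜ Shrink.{0} W` (a compact manifold is small) with the composed charts, whose boundary
  corresponds; fundamental classes of `(W, ∂W)` correspond (Spanier's pointwise definition, local
  homology across universes `localHomology.xEquiv`), and bijectivity of `a ↦ a ⌢ z` is invariant
  (`relativeSingularHomology.bijective_relCapProduct_iff_of_homeomorph`, `…UniverseTransportCap`);

* `two_mul_boundaryImageRank_eq_of_lefschetz` — **Thom 1952 Cor. V.8 (`n = 4`, `p = 2`) from
  Lefschetz duality alone**;
* `exists_isotropic_of_isOrientedBordant_of_isEmpty_of_lefschetz`,
  `signature_eq_zero_of_isOrientedBordant_of_isEmpty_of_lefschetz` — Thom 1952 Thm V.10 and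
  Cor. V.11 in dimension four (an oriented boundary carries a Lagrangian; its signature vanishes)
  from Lefschetz duality alone;
* `signature_eq_of_isOrientedBordant_of_lefschetz` — **Thom 1954 Thm IV.1 in dimension four
  from Lefschetz duality alone**;
* `isOrientedBordant_iff_signature_eq_of_lefschetz` — spc4.S36 from `hL` and Thom's Thm IV.13
  (`h₂`, `Ω⁴ ≅ ℤ` detected by the signature — the converse direction);
* `two_mul_boundaryImageRank_eq_of_lefschetz₀`, `signature_eq_of_isOrientedBordant_of_lefschetz₀`
  — the same from Lefschetz duality for compact 5-manifolds with boundary **in `Type` only**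
  (`hL₀`).

Lefschetz duality is now a theorem of `Literature` too
(`Literature.AlgebraicTopology.SingularHomology.bijective_relCapProduct_of_isRelFundamentalClass_holds`,
`…LefschetzDualityProofs`: Čech duality for `W` in its external collar oriented by the relative
fundamental class, Miller's Thm. 37.1, transported to every universe).  Hence the DISCHARGE:

* `two_mul_boundaryImageRank_eq_holds` — **Thom 1952, Cor. V.8 for `n = 4`, `p = 2`**
  (`2 r₂ = b₂(M) + b₂(N)`), the named fact `two_mul_boundaryImageRank_eq`, PROVED;
  REMAINING HYPOTHESES for the leaf `two_mul_boundaryImageRank_eq`: 0.  (Thm V.10 / Cor. V.11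
  and Thm IV.1 themselves are discharged in the siblings
  `Literature.Topology.FourManifolds.BordismFourSignatureZero` and
  `Literature.Topology.FourManifolds.SignatureBordismInvariance`.)

## References

* R. Thom, *Espaces fibrés en sphères et carrés de Steenrod*, Ann. Sci. ENS 69 (1952), Thm V.7
  and Cor. V.8 (p. 173, eq. (71): `r_p + r_{n−p} = b_p(V) = b_{n−p}(V)`), Thm V.10 and Cor. V.11
  (p. 176). [Thom1952]
* R. Thom, *Quelques propriétés globales des variétés différentiables*, Comment. Math. Helv. 28
  (1954), Thm IV.1 (p. 65), Thm IV.13 (p. 81). [ThomCMH1954]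
* A. Hatcher, *Algebraic Topology*, CUP 2002, §2.1 (naturality for pairs), §3.3 Thm. 3.30,
  p. 241 (naturality of the cap product). [Hatcher2002]
* E. H. Spanier, *Algebraic Topology*, Springer 1981, Ch. 6 §3, definition of fundamental class
  (after Cor. 8) and Thm. 12. [Spanier1981]
-/

noncomputable section

open scoped Manifold ContDiff Topology
open CategoryTheory Set

universe u u' v

namespace Literature.Topology.FourManifolds

/-! ### Lefschetz duality in every universe from Lefschetz duality in `Type` -/

section UniverseLift

open Literature.AlgebraicTopology.SingularHomology

variable {R : Type v} [CommRing R]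
variable {X : Type u} {Y : Type u'} [TopologicalSpace X] [TopologicalSpace Y]

/-- The boundary of a charted space structure obtained by composing the charts of `X` with a
homeomorphism `f : Y ≃ₜ X` (`ChartedSpace.comp` through the one-chart atlas `{f}`): `y` is a
boundary point of `Y` iff `f y` is a boundary point of `X` (the preferred chart at `y` is
`f ≫ chartAt (f y)`). [folklore] -/
theorem isBoundaryPoint_comp_iff {𝕜 : Type*} [NontriviallyNormedField 𝕜] {E : Type*}
    [NormedAddCommGroup E] [NormedSpace 𝕜 E] {H : Type*} [TopologicalSpace H]
    (I : ModelWithCorners 𝕜 E H) [ChartedSpace H X] (f : Y ≃ₜ X) (y : Y) :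
    (letI : ChartedSpace X Y := f.toOpenPartialHomeomorph.singletonChartedSpace rfl
     letI : ChartedSpace H Y := ChartedSpace.comp H X Y
     I.IsBoundaryPoint y) ↔ I.IsBoundaryPoint (f y) := by
  letI : ChartedSpace X Y := f.toOpenPartialHomeomorph.singletonChartedSpace rfl
  letI : ChartedSpace H Y := ChartedSpace.comp H X Y
  rw [ModelWithCorners.isBoundaryPoint_iff, ModelWithCorners.isBoundaryPoint_iff, extChartAt_coe,
    extChartAt_coe, Function.comp_apply, Function.comp_apply, chartAt_comp]
  rfl

variable (R)

/-- **Fundamental classes of manifolds with boundary correspond across universes**: for a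
homeomorphism of pairs `e : (X, A) ≅ (Y, B)` between spaces in different universes and
`z ∈ Hₘ(X, A; R)`, `z` is a fundamental class of `(X, A)` iff `e_* z` is one of `(Y, B)`
(Spanier's definition: generators of the local homology at the points off the boundary; local
homology is transported by `localHomology.xEquiv`). [cite: Spanier1981, Ch. 6 Sec. 3 (definition of fundamental class)] -/
theorem isRelFundamentalClass_iff_of_xEquiv (e : X ≃ₜ Y) {A : Set X} {B : Set Y}
    (hAB : MapsTo e A B) (hBA : MapsTo e.symm B A) {m : ℕ} (z : relativeSingularHomology R R X A m) :
    IsRelFundamentalClass R A z ↔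
      IsRelFundamentalClass R B (relativeSingularHomology.xEquiv R R e hAB hBA m z) := by
  -- `toLocal` across universes
  have hloc : ∀ x : ↥Aᶜ, localHomology.xEquiv R R e (x : X) m (relativeSingularHomology.toLocal R R A x m z) =
      relativeSingularHomology.toLocal R R B ⟨e x, fun h => x.2 (by simpa using hBA h)⟩ m
        (relativeSingularHomology.xEquiv R R e hAB hBA m z) := fun x =>
    relativeSingularHomology.xEquiv_map R R e e (ContinuousMap.id X) (ContinuousMap.id Y)
      (fun _ => rfl) _ _ _ _ _ _ m z
  constructor
  · intro hz y
    set x : ↥Aᶜ := ⟨e.symm y, fun h => y.2 (by simpa using hAB h)⟩ with hx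
    obtain ⟨e₀, he₀⟩ := hz x
    have hy : (⟨e x, fun h => x.2 (by simpa using hBA h)⟩ : ↥Bᶜ) = y := Subtype.ext (by simp [hx])
    rw [← hy]
    exact ⟨(localHomology.xEquiv R R e (x : X) m).symm.trans e₀, by
      rw [LinearEquiv.trans_apply, ← hloc x, LinearEquiv.symm_apply_apply, he₀]⟩
  · intro hz x
    obtain ⟨e₀, he₀⟩ := hz ⟨e x, fun h => x.2 (by simpa using hBA h)⟩
    exact ⟨(localHomology.xEquiv R R e (x : X) m).trans e₀, by
      rw [LinearEquiv.trans_apply, hloc x, he₀]⟩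

/-- **Lefschetz duality in every universe from Lefschetz duality in `Type`**: if Spanier's
Thm. 6.3.12 (`bijective_relCapProduct_of_isRelFundamentalClass`: cap product with a fundamental
class, `Hᵖ(W; R) → H_q(W, ∂W; R)`, is bijective) holds for all compact `(n+1)`-manifolds with
boundary `W₀ : Type`, then it holds for all `W : Type u`: transport along `W ≃ₜ Shrink.{0} W`
(a compact manifold is small, `small_of_compactSpace_chartedSpace`) with the composed charts,
whose boundary corresponds (`isBoundaryPoint_comp_iff`); fundamental classes correspond
(`isRelFundamentalClass_iff_of_xEquiv`) and bijectivity of `a ↦ a ⌢ z` is invariant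
(`relativeSingularHomology.bijective_relCapProduct_iff_of_homeomorph`, `…UniverseTransportCap`).
[cite: Spanier1981, Ch. 6 Sec. 3 Thm. 12] -/
theorem bijective_relCapProduct_of_isRelFundamentalClass_of_univ {n p q : ℕ} (h : p + q = n + 1)
    (H : ∀ {W₀ : Type} [TopologicalSpace W₀] [T2Space W₀] [CompactSpace W₀]
      [ChartedSpace (EuclideanHalfSpace (n + 1)) W₀]
      (z₀ : relativeSingularHomology R R W₀ ((𝓡∂ (n + 1)).boundary W₀) (n + 1))
      (hz₀ : IsRelFundamentalClass R ((𝓡∂ (n + 1)).boundary W₀) z₀),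
      bijective_relCapProduct_of_isRelFundamentalClass R n W₀ z₀ hz₀ h)
    {W : Type u} [TopologicalSpace W] [T2Space W] [CompactSpace W]
    [ChartedSpace (EuclideanHalfSpace (n + 1)) W]
    (z : relativeSingularHomology R R W ((𝓡∂ (n + 1)).boundary W) (n + 1))
    (hz : IsRelFundamentalClass R ((𝓡∂ (n + 1)).boundary W) z) :
    bijective_relCapProduct_of_isRelFundamentalClass R n W z hz h := by
  haveI : SecondCountableTopology (EuclideanHalfSpace (n + 1)) :=
    TopologicalSpace.Subtype.secondCountableTopology _
  haveI : Small.{0} W := small_of_compactSpace_chartedSpace (EuclideanHalfSpace (n + 1))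
  let φ : W ≃ₜ Shrink.{0} W := Shrink.homeomorph W
  haveI : T2Space (Shrink.{0} W) := φ.t2Space
  haveI : CompactSpace (Shrink.{0} W) := φ.compactSpace
  letI : ChartedSpace W (Shrink.{0} W) := φ.symm.toOpenPartialHomeomorph.singletonChartedSpace rfl
  letI : ChartedSpace (EuclideanHalfSpace (n + 1)) (Shrink.{0} W) :=
    ChartedSpace.comp (EuclideanHalfSpace (n + 1)) W (Shrink.{0} W)
  have hb : ∀ y : Shrink.{0} W, y ∈ (𝓡∂ (n + 1)).boundary (Shrink.{0} W) ↔
      φ.symm y ∈ (𝓡∂ (n + 1)).boundary W := fun y =>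
    isBoundaryPoint_comp_iff (𝓡∂ (n + 1)) φ.symm y
  have hAB : MapsTo φ ((𝓡∂ (n + 1)).boundary W) ((𝓡∂ (n + 1)).boundary (Shrink.{0} W)) :=
    fun x hx => (hb _).2 (by simpa using hx)
  have hBA : MapsTo φ.symm ((𝓡∂ (n + 1)).boundary (Shrink.{0} W)) ((𝓡∂ (n + 1)).boundary W) :=
    fun y hy => (hb y).1 hy
  have hz' : IsRelFundamentalClass R ((𝓡∂ (n + 1)).boundary (Shrink.{0} W))
      (relativeSingularHomology.xEquiv R R φ hAB hBA (n + 1) z) :=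
    (isRelFundamentalClass_iff_of_xEquiv R φ hAB hBA z).1 hz
  exact (relativeSingularHomology.bijective_relCapProduct_iff_of_homeomorph φ hAB hBA h z).2
    (H _ hz')

end UniverseLift

section SPC4

/-- **The leaf `two_mul_boundaryImageRank_eq` (Thom 1952, Cor. V.8 for `n = 4`, `p = 2`:
`2 · r₂ = b₂(M) + b₂(N)`) from Lefschetz duality alone** (`hL`, Spanier Thm. 6.3.12 for compact
5-manifolds with boundary): Poincaré duality for the closed ends (Hatcher Thm. 3.30) is the
theorem `poincare_duality` of `Literature`, and all finiteness, universal-coefficient and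
normalization inputs were discharged in the earlier layers.  PROVED.
[cite: Thom1952, Cor. V.8 (p. 173)] -/
theorem two_mul_boundaryImageRank_eq_of_lefschetz
    (hL : ∀ {W : Type u} [TopologicalSpace W] [T2Space W] [CompactSpace W]
      [ChartedSpace (EuclideanHalfSpace (4 + 1)) W]
      (z : ↥(Literature.AlgebraicTopology.SingularHomology.relativeSingularHomology ℤ ℤ W ((𝓡∂ (4 + 1)).boundary W) (4 + 1)))
      (hz : Literature.AlgebraicTopology.SingularHomology.IsRelFundamentalClass ℤ ((𝓡∂ (4 + 1)).boundary W) z),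
      Literature.AlgebraicTopology.SingularHomology.bijective_relCapProduct_of_isRelFundamentalClass ℤ 4 W z hz (show 2 + (2 + 1) = 4 + 1 by rfl)) :
    two_mul_boundaryImageRank_eq.{u} :=
  two_mul_boundaryImageRank_eq_of_duality' hL
    (fun π => Literature.AlgebraicTopology.SingularHomology.poincare_duality π two_add_two_eq_four)

/-- **Thom 1952, Thm V.10 in dimension four, from Lefschetz duality alone**: a closed smooth
`ℤ`-oriented 4-manifold which is an oriented boundary carries a half-rank isotropic sublattice of
`H²(P; ℤ)/T` for its intersection form.  PROVED (Cor. V.8 + the proved half of Thm V.7).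
[cite: Thom1952, Thm V.10 (p. 176)] -/
theorem exists_isotropic_of_isOrientedBordant_of_isEmpty_of_lefschetz
    (hL : ∀ {W : Type u} [TopologicalSpace W] [T2Space W] [CompactSpace W]
      [ChartedSpace (EuclideanHalfSpace (4 + 1)) W]
      (z : ↥(Literature.AlgebraicTopology.SingularHomology.relativeSingularHomology ℤ ℤ W ((𝓡∂ (4 + 1)).boundary W) (4 + 1)))
      (hz : Literature.AlgebraicTopology.SingularHomology.IsRelFundamentalClass ℤ ((𝓡∂ (4 + 1)).boundary W) z),
      Literature.AlgebraicTopology.SingularHomology.bijective_relCapProduct_of_isRelFundamentalClass ℤ 4 W z hz (show 2 + (2 + 1) = 4 + 1 by rfl)) :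
    exists_isotropic_of_isOrientedBordant_of_isEmpty.{u} :=
  exists_isotropic_of_isOrientedBordant_of_isEmpty_of (two_mul_boundaryImageRank_eq_of_lefschetz hL)

/-- **Thom 1952, Cor. V.11 in dimension four, from Lefschetz duality alone**: the signature of
an oriented boundary vanishes.  PROVED (Thm V.10, Sylvester's law for the unimodular cup form —
`sigPos_add_sigNeg_intersectionForm_four_of_facts` with Poincaré duality, universal coefficients,
graded commutativity and finiteness all theorems — and finiteness of `H²`).
[cite: Thom1952, Cor. V.11 (p. 176)] -/
theorem signature_eq_zero_of_isOrientedBordant_of_isEmpty_of_lefschetz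
    (hL : ∀ {W : Type u} [TopologicalSpace W] [T2Space W] [CompactSpace W]
      [ChartedSpace (EuclideanHalfSpace (4 + 1)) W]
      (z : ↥(Literature.AlgebraicTopology.SingularHomology.relativeSingularHomology ℤ ℤ W ((𝓡∂ (4 + 1)).boundary W) (4 + 1)))
      (hz : Literature.AlgebraicTopology.SingularHomology.IsRelFundamentalClass ℤ ((𝓡∂ (4 + 1)).boundary W) z),
      Literature.AlgebraicTopology.SingularHomology.bijective_relCapProduct_of_isRelFundamentalClass ℤ 4 W z hz (show 2 + (2 + 1) = 4 + 1 by rfl)) :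
    signature_eq_zero_of_isOrientedBordant_of_isEmpty.{u} :=
  signature_eq_zero_of_isOrientedBordant_of_isEmpty_of_exists_isotropic
    (exists_isotropic_of_isOrientedBordant_of_isEmpty_of_lefschetz hL)
    (fun {P} _ _ _ _ π => sigPos_add_sigNeg_intersectionForm_four_of_facts π
      (Literature.AlgebraicTopology.SingularHomology.poincare_duality π two_add_two_eq_four)
      (Literature.AlgebraicTopology.SingularHomology.kroneckerMap_surjective_holds ℤ P 2)
      (@Literature.AlgebraicTopology.SingularHomology.ker_kroneckerMap_le_torsion_holds ℤ _ _ _ P _ 1)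
      (Literature.AlgebraicTopology.SingularHomology.finite_singularCohomology_of_compactSpace_of_isPrincipalIdealRing ℤ P 4 2)
      (Literature.AlgebraicTopology.SingularHomology.finite_singularHomology_of_compactSpace_holds ℤ P 4 1)
      (Literature.AlgebraicTopology.SingularHomology.cupProduct_gradedComm_holds ℤ P))
    (fun {P} _ _ _ _ =>
      Literature.AlgebraicTopology.SingularHomology.finite_singularCohomology_of_compactSpace_of_isPrincipalIdealRing ℤ P 4 2)

/-- **Thom's Thm IV.1 in dimension four (bordism invariance of the signature) from Lefschetz
duality alone** (`hL`, Spanier Thm. 6.3.12): if two closed oriented smooth 4-manifolds are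
oriented bordant, their signatures agree.  PROVED. [cite: ThomCMH1954, Thm IV.1 (p. 65)] -/
theorem signature_eq_of_isOrientedBordant_of_lefschetz
    (hL : ∀ {W : Type u} [TopologicalSpace W] [T2Space W] [CompactSpace W]
      [ChartedSpace (EuclideanHalfSpace (4 + 1)) W]
      (z : ↥(Literature.AlgebraicTopology.SingularHomology.relativeSingularHomology ℤ ℤ W ((𝓡∂ (4 + 1)).boundary W) (4 + 1)))
      (hz : Literature.AlgebraicTopology.SingularHomology.IsRelFundamentalClass ℤ ((𝓡∂ (4 + 1)).boundary W) z),
      Literature.AlgebraicTopology.SingularHomology.bijective_relCapProduct_of_isRelFundamentalClass ℤ 4 W z hz (show 2 + (2 + 1) = 4 + 1 by rfl)) :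
    signature_eq_of_isOrientedBordant.{u} :=
  signature_eq_of_isOrientedBordant_of_duality'' hL
    (fun π => Literature.AlgebraicTopology.SingularHomology.poincare_duality π two_add_two_eq_four)

/-- **spc4.S36 (`isOrientedBordant_iff_signature_eq`) from Lefschetz duality and Thom's
Thm IV.13** — two inputs: `hL` (Spanier Thm. 6.3.12, compact 5-manifolds with boundary) and `h₂`
(`Ω⁴ ≅ ℤ` detected by the signature, the converse direction).  PROVED.
[cite: ThomCMH1954, Thm IV.1 (p. 65) and Thm IV.13 (p. 81)] -/
theorem isOrientedBordant_iff_signature_eq_of_lefschetz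
    (hL : ∀ {W : Type u} [TopologicalSpace W] [T2Space W] [CompactSpace W]
      [ChartedSpace (EuclideanHalfSpace (4 + 1)) W]
      (z : ↥(Literature.AlgebraicTopology.SingularHomology.relativeSingularHomology ℤ ℤ W ((𝓡∂ (4 + 1)).boundary W) (4 + 1)))
      (hz : Literature.AlgebraicTopology.SingularHomology.IsRelFundamentalClass ℤ ((𝓡∂ (4 + 1)).boundary W) z),
      Literature.AlgebraicTopology.SingularHomology.bijective_relCapProduct_of_isRelFundamentalClass ℤ 4 W z hz (show 2 + (2 + 1) = 4 + 1 by rfl))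
    (h₂ : isOrientedBordant_of_signature_eq.{u}) : isOrientedBordant_iff_signature_eq.{u} :=
  isOrientedBordant_iff_signature_eq_of (signature_eq_of_isOrientedBordant_of_lefschetz hL) h₂

/-- **The leaf `two_mul_boundaryImageRank_eq` from Lefschetz duality in `Type` alone** (`hL₀`:
Spanier Thm. 6.3.12 for compact 5-manifolds with boundary `W : Type`): the instance of `hL` in
universe `u` follows by `bijective_relCapProduct_of_isRelFundamentalClass_of_univ`.  PROVED.
[cite: Thom1952, Cor. V.8 (p. 173)] -/
theorem two_mul_boundaryImageRank_eq_of_lefschetz₀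
    (hL₀ : ∀ {W : Type} [TopologicalSpace W] [T2Space W] [CompactSpace W]
      [ChartedSpace (EuclideanHalfSpace (4 + 1)) W]
      (z : ↥(Literature.AlgebraicTopology.SingularHomology.relativeSingularHomology ℤ ℤ W ((𝓡∂ (4 + 1)).boundary W) (4 + 1)))
      (hz : Literature.AlgebraicTopology.SingularHomology.IsRelFundamentalClass ℤ ((𝓡∂ (4 + 1)).boundary W) z),
      Literature.AlgebraicTopology.SingularHomology.bijective_relCapProduct_of_isRelFundamentalClass ℤ 4 W z hz (show 2 + (2 + 1) = 4 + 1 by rfl)) :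
    two_mul_boundaryImageRank_eq.{u} :=
  two_mul_boundaryImageRank_eq_of_lefschetz (fun z hz =>
    bijective_relCapProduct_of_isRelFundamentalClass_of_univ ℤ (show 2 + (2 + 1) = 4 + 1 by rfl)
      hL₀ z hz)

/-- **Thom's Thm IV.1 in dimension four from Lefschetz duality in `Type` alone.**  PROVED.
[cite: ThomCMH1954, Thm IV.1 (p. 65)] -/
theorem signature_eq_of_isOrientedBordant_of_lefschetz₀
    (hL₀ : ∀ {W : Type} [TopologicalSpace W] [T2Space W] [CompactSpace W]
      [ChartedSpace (EuclideanHalfSpace (4 + 1)) W]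
      (z : ↥(Literature.AlgebraicTopology.SingularHomology.relativeSingularHomology ℤ ℤ W ((𝓡∂ (4 + 1)).boundary W) (4 + 1)))
      (hz : Literature.AlgebraicTopology.SingularHomology.IsRelFundamentalClass ℤ ((𝓡∂ (4 + 1)).boundary W) z),
      Literature.AlgebraicTopology.SingularHomology.bijective_relCapProduct_of_isRelFundamentalClass ℤ 4 W z hz (show 2 + (2 + 1) = 4 + 1 by rfl)) :
    signature_eq_of_isOrientedBordant.{u} :=
  signature_eq_of_isOrientedBordant_of_lefschetz (fun z hz =>
    bijective_relCapProduct_of_isRelFundamentalClass_of_univ ℤ (show 2 + (2 + 1) = 4 + 1 by rfl)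
      hL₀ z hz)

/-- **spc4.S36 from Lefschetz duality in `Type` and Thom's Thm IV.13.**  PROVED.
[cite: ThomCMH1954, Thm IV.1 (p. 65) and Thm IV.13 (p. 81)] -/
theorem isOrientedBordant_iff_signature_eq_of_lefschetz₀
    (hL₀ : ∀ {W : Type} [TopologicalSpace W] [T2Space W] [CompactSpace W]
      [ChartedSpace (EuclideanHalfSpace (4 + 1)) W]
      (z : ↥(Literature.AlgebraicTopology.SingularHomology.relativeSingularHomology ℤ ℤ W ((𝓡∂ (4 + 1)).boundary W) (4 + 1)))
      (hz : Literature.AlgebraicTopology.SingularHomology.IsRelFundamentalClass ℤ ((𝓡∂ (4 + 1)).boundary W) z),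
      Literature.AlgebraicTopology.SingularHomology.bijective_relCapProduct_of_isRelFundamentalClass ℤ 4 W z hz (show 2 + (2 + 1) = 4 + 1 by rfl))
    (h₂ : isOrientedBordant_of_signature_eq.{u}) : isOrientedBordant_iff_signature_eq.{u} :=
  isOrientedBordant_iff_signature_eq_of (signature_eq_of_isOrientedBordant_of_lefschetz₀ hL₀) h₂

/-! ### The discharge: Thom's Cor. V.8 (1952) in dimension four -/

/-- **Thom 1952, Cor. V.8 for `n = 4`, `p = 2` — discharge of the named fact
`two_mul_boundaryImageRank_eq`** (Ann. Sci. ENS 69, p. 173, eq. (71): "Entre les rangs de `Aᵖ` et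
`A^{n−p}` on a la relation : `r_p + r_{n−p} = b_p(V) = b_{n−p}(V)`"): for an oriented cobordism
`W` between closed oriented smooth 4-manifolds `M`, `N` (orientation as a relative class
`w ∈ H₅(W, ∂W; ℤ)` with `∂w = (inl)_*[M] − (inr)_*[N]`), the image `A² = i^* H²(W)` in
`H²(M; ℤ)/T ⊕ H²(N; ℤ)/T` has rank `r₂` with `2 r₂ = b₂(M) + b₂(N)`.  PROVED: Lefschetz duality
(`bijective_relCapProduct_of_isRelFundamentalClass_holds`) and Poincaré duality
(`poincare_duality`) are theorems of `Literature`, and the earlier layers reduced the fact to them.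
[cite: Thom1952, Cor. V.8 (p. 173)] -/
theorem two_mul_boundaryImageRank_eq_holds : two_mul_boundaryImageRank_eq.{u} :=
  two_mul_boundaryImageRank_eq_of_lefschetz (fun z hz =>
    Literature.AlgebraicTopology.SingularHomology.bijective_relCapProduct_of_isRelFundamentalClass_holds
      4 _ z hz _)

end SPC4

end Literature.Topology.FourManifolds

end
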